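import Mathlib
import Literature.Analysis.FluidPDE.AxisymNoSwirlVorticity
import Summits.NavierStokesRegularity.NavierStokesRegularity.Theorems.EulerZoomLiouvillePowerGaugeEulerLiouvilleHoopAxisAtom

/-!
# R48 plate t51-CM (1/2): the CROSS-MODE law (pointwise part) (nsreg-p2 ROUND-48 «EVERY LINE, EVERY BEND», `NsregP2.R48.CrossModeIdentity`,
text VERBATIM from `r48/Sketch48.lean` c9b3454dee49e2f5 l.99–106; seat ns-ezl-w2 g5, `--supports stmt-NavierStokesRegularity-19832 --as helper`)

For `C¹` divergence-free `V`, a transverse vector `c` (`c₂ = 0`), every `s` and `T₀ > 0`: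
`2∫₀^{T₀} ⟨c_r V_r − c_θ V_θ⟩_θ dt/t = −∫₀^{T₀} ⟨c_r ∂_zV_z + c_θ ω_z⟩_θ dt − ⟨c_r V_r − c_θ V_θ⟩_θ(s, T₀)`.
Proof in the smooth slice chart (ns-sfl-p1 g8 `…HoopSliceChart`, ns-ezl-w3 g7 `…HoopAxisAtom`): with
`m(t) = ∫_θ (c_r a − c_θ b)`, `n(t) = ∫_θ (c_r ∂_σc + c_θ ω_z)` (`ω_z = ⟨DV R_θe₀, R_θe₁⟩ − ⟨DV R_θe₁, R_θe₀⟩`,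
`curl_two_eq_rotFrame`), the pointwise law `2 m + t m′ = −t n` (`crossMode_pointwise_law`: `div V = 0` in the rotated frame and two
`θ`-integrations by parts with `c_r′ = c_θ`, `c_θ′ = −c_r`); `m(0) = 0` (a pure second azimuthal mode on the axis); then
`2m/t = −n − m′` on `(0, T₀]` and the fundamental theorem of calculus.  The `t = 0` junk values of `eR`, `eTheta` are invisible
(`integral_congr_ae` on `Ι 0 T₀`).

HONEST FRAMING: class-free calculus (a statement of a ROUND-48 instrument); nothing about the crux E (19832 OPEN) or NS regularity.
[nsreg-p2 R48 §1.3; folklore (real-variable `∂_z̄`-Green on the punctured disc)]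
-/

noncomputable section

open Set Filter Topology Metric Function MeasureTheory Real WithLp
open scoped Interval InnerProductSpace RealInnerProductSpace

set_option linter.dupNamespace false

namespace Summit.NavierStokesRegularity.NavierStokesRegularity.Theorems.PowerGaugeEulerLiouville.HoopCore

open Literature.Analysis Literature.Analysis.FluidPDE

variable {V : EuclideanSpace ℝ (Fin 3) → EuclideanSpace ℝ (Fin 3)}

/-- The axial vorticity in the rotated frame: `(L e₀)₁ − (L e₁)₀ = ⟪L R_θe₀, R_θe₁⟫ − ⟪L R_θe₁, R_θe₀⟫` (the antisymmetric part of the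
horizontal block is rotation invariant). [folklore] -/
theorem curl_two_eq_rotFrame (L : EuclideanSpace ℝ (Fin 3) →L[ℝ] EuclideanSpace ℝ (Fin 3)) (θ : ℝ) :
    L (EuclideanSpace.single 0 1) 1 - L (EuclideanSpace.single 1 1) 0 =
      ⟪L (rotZ θ (EuclideanSpace.single (0 : Fin 3) (1 : ℝ))), rotZ θ (EuclideanSpace.single (1 : Fin 3) (1 : ℝ))⟫ - ⟪L
          (rotZ θ (EuclideanSpace.single (1 : Fin 3) (1 : ℝ))), rotZ θ (EuclideanSpace.single (0 : Fin 3) (1 : ℝ))⟫ := by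
  simp only [rotZ_single_zero_eq, rotZ_single_one_eq, map_add, map_smul, map_neg, neg_smul,
    inner_add_left, inner_add_right, inner_smul_right, inner_smul_left, inner_neg_left, inner_neg_right,
    EuclideanSpace.inner_single_right]
  simp only [conj_trivial]
  have h := Real.sin_sq_add_cos_sq θ
  linear_combination (L (EuclideanSpace.single 1 1) 0 - L (EuclideanSpace.single 0 1) 1) * h

/-- `θ ↦ ⟪c, R_θe₀⟫` has derivative `⟪c, R_θe₁⟫`. [folklore] -/
theorem hasDerivAt_inner_rotZ_single_zero (c : EuclideanSpace ℝ (Fin 3)) (θ : ℝ) :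
    HasDerivAt (fun θ : ℝ => ⟪c, rotZ θ (EuclideanSpace.single (0 : Fin 3) (1 : ℝ))⟫) (⟪c, rotZ θ
        (EuclideanSpace.single (1 : Fin 3) (1 : ℝ))⟫) θ := by
  have h := (hasDerivAt_const θ c).inner ℝ (hasDerivAt_rotZ_single_zero θ)
  simpa only [inner_zero_left, add_zero] using h

/-- `θ ↦ ⟪c, R_θe₁⟫` has derivative `−⟪c, R_θe₀⟫`. [folklore] -/
theorem hasDerivAt_inner_rotZ_single_one (c : EuclideanSpace ℝ (Fin 3)) (θ : ℝ) :
    HasDerivAt (fun θ : ℝ => ⟪c, rotZ θ (EuclideanSpace.single (1 : Fin 3) (1 : ℝ))⟫) (-⟪c, rotZ θ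
        (EuclideanSpace.single (0 : Fin 3) (1 : ℝ))⟫) θ := by
  have h := (hasDerivAt_const θ c).inner ℝ (hasDerivAt_rotZ_single_one θ)
  simpa only [inner_zero_left, add_zero, inner_neg_right] using h

/-- **The pointwise law `2 m(t) + t m′(t) = −t n(t)`** of the cross mode (every real `t`; `div V = 0`):
`m(t) = ∫_θ (c_r a − c_θ b)`, `m′(t) = ∫_θ (c_r ⟨DV R_θe₀, R_θe₀⟩ − c_θ ⟨DV R_θe₀, R_θe₁⟩)`,
`n(t) = ∫_θ (c_r ⟨DV e_z, e_z⟩ + c_θ (⟨DV R_θe₀, R_θe₁⟩ − ⟨DV R_θe₁, R_θe₀⟩))`. [nsreg-p2 R48 §1.3; folklore] -/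
theorem crossMode_pointwise_law (hV : ContDiff ℝ 1 V) (hdiv : ∀ y, VectorCalculus.divergence V y = 0)
    (c : EuclideanSpace ℝ (Fin 3)) (s t : ℝ) :
    2 * (∫ θ in (0 : ℝ)..2 * π, (⟪c, rotZ θ (EuclideanSpace.single (0 : Fin 3) (1 : ℝ))⟫ * ⟪V (axisPt s t θ),
        rotZ θ (EuclideanSpace.single (0 : Fin 3) (1 : ℝ))⟫ - ⟪c, rotZ θ (EuclideanSpace.single (1 : Fin 3) (1 : ℝ))⟫
        * ⟪V (axisPt s t θ), rotZ θ (EuclideanSpace.single (1 : Fin 3) (1 : ℝ))⟫)) +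
        t * (∫ θ in (0 : ℝ)..2 * π, (⟪c, rotZ θ (EuclideanSpace.single (0 : Fin 3) (1 : ℝ))⟫
            * ⟪fderiv ℝ V (axisPt s t θ) (rotZ θ (EuclideanSpace.single (0 : Fin 3) (1 : ℝ))), rotZ θ
            (EuclideanSpace.single (0 : Fin 3) (1 : ℝ))⟫ - ⟪c, rotZ θ (EuclideanSpace.single (1 : Fin 3) (1 : ℝ))⟫
            * ⟪fderiv ℝ V (axisPt s t θ) (rotZ θ (EuclideanSpace.single (0 : Fin 3) (1 : ℝ))), rotZ θ
            (EuclideanSpace.single (1 : Fin 3) (1 : ℝ))⟫)) =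
      -(t * ∫ θ in (0 : ℝ)..2 * π, (⟪c, rotZ θ (EuclideanSpace.single (0 : Fin 3) (1 : ℝ))⟫
          * ⟪fderiv ℝ V (axisPt s t θ) eZ, eZ⟫ + ⟪c, rotZ θ
          (EuclideanSpace.single (1 : Fin 3) (1 : ℝ))⟫ * (⟪fderiv ℝ V (axisPt s t θ) (rotZ θ
          (EuclideanSpace.single (0 : Fin 3) (1 : ℝ))), rotZ θ
          (EuclideanSpace.single (1 : Fin 3) (1 : ℝ))⟫ - ⟪fderiv ℝ V (axisPt s t θ) (rotZ θ
          (EuclideanSpace.single (1 : Fin 3) (1 : ℝ))), rotZ θ (EuclideanSpace.single (0 : Fin 3) (1 : ℝ))⟫))) := by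
  have hVd : Differentiable ℝ V := hV.differentiable one_ne_zero
  have hVc : Continuous V := hV.continuous
  -- continuity in `θ` of everything in sight (sections of the chart functions)
  have sec : ∀ {F : ℝ × ℝ × ℝ → ℝ}, Continuous F → Continuous fun θ : ℝ => F (s, t, θ) :=
    fun hF => hF.comp (continuous_const.prodMk (continuous_const.prodMk continuous_id))
  have hcr : Continuous fun θ : ℝ => ⟪c, rotZ θ (EuclideanSpace.single (0 : Fin 3) (1 : ℝ))⟫ := continuous_const.inner continuous_rotZ_single_zero
  have hcθ : Continuous fun θ : ℝ => ⟪c, rotZ θ (EuclideanSpace.single (1 : Fin 3) (1 : ℝ))⟫ := continuous_const.inner continuous_rotZ_single_one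
  have ha : Continuous fun θ : ℝ => ⟪V (axisPt s t θ), rotZ θ
      (EuclideanSpace.single (0 : Fin 3) (1 : ℝ))⟫ := sec (continuous_sliceA hVc)
  have hb : Continuous fun θ : ℝ => ⟪V (axisPt s t θ), rotZ θ
      (EuclideanSpace.single (1 : Fin 3) (1 : ℝ))⟫ := sec (continuous_sliceB hVc)
  have had : Continuous fun θ : ℝ => ⟪fderiv ℝ V (axisPt s t θ) (rotZ θ (EuclideanSpace.single (0 : Fin 3) (1 : ℝ))),
      rotZ θ (EuclideanSpace.single (0 : Fin 3) (1 : ℝ))⟫ :=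
    sec (continuous_sliceEntry hV continuous_rotZ_single_zero continuous_rotZ_single_zero)
  have hbd : Continuous fun θ : ℝ => ⟪fderiv ℝ V (axisPt s t θ) (rotZ θ (EuclideanSpace.single (0 : Fin 3) (1 : ℝ))),
      rotZ θ (EuclideanSpace.single (1 : Fin 3) (1 : ℝ))⟫ :=
    sec (continuous_sliceEntry hV continuous_rotZ_single_zero continuous_rotZ_single_one)
  have hmr : Continuous fun θ : ℝ => ⟪fderiv ℝ V (axisPt s t θ) (rotZ θ (EuclideanSpace.single (1 : Fin 3) (1 : ℝ))),
      rotZ θ (EuclideanSpace.single (0 : Fin 3) (1 : ℝ))⟫ :=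
    sec (continuous_sliceEntry hV continuous_rotZ_single_one continuous_rotZ_single_zero)
  have hmθ : Continuous fun θ : ℝ => ⟪fderiv ℝ V (axisPt s t θ) (rotZ θ (EuclideanSpace.single (1 : Fin 3) (1 : ℝ))),
      rotZ θ (EuclideanSpace.single (1 : Fin 3) (1 : ℝ))⟫ :=
    sec (continuous_sliceEntry hV continuous_rotZ_single_one continuous_rotZ_single_one)
  have hcs : Continuous fun θ : ℝ => ⟪fderiv ℝ V (axisPt s t θ) eZ, eZ⟫ :=
    sec (continuous_sliceEntry hV (u := fun _ => eZ) (w := fun _ => eZ) continuous_const continuous_const)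
  -- (1) pointwise: `c_r·(t ad) − c_θ·(t bd) = −c_r·(∂_θ b) − c_θ·(∂_θ a) − (c_r a − c_θ b) − t·(c_r cσ + c_θ ω_z)`
  have hpt : ∀ θ, t * (⟪c, rotZ θ (EuclideanSpace.single (0 : Fin 3) (1 : ℝ))⟫ * ⟪fderiv ℝ V (axisPt s t θ)
      (rotZ θ (EuclideanSpace.single (0 : Fin 3) (1 : ℝ))), rotZ θ (EuclideanSpace.single (0 : Fin 3) (1 : ℝ))⟫ - ⟪c,
      rotZ θ (EuclideanSpace.single (1 : Fin 3) (1 : ℝ))⟫ * ⟪fderiv ℝ V (axisPt s t θ) (rotZ θ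
      (EuclideanSpace.single (0 : Fin 3) (1 : ℝ))), rotZ θ (EuclideanSpace.single (1 : Fin 3) (1 : ℝ))⟫) =
      -(⟪c, rotZ θ (EuclideanSpace.single (0 : Fin 3) (1 : ℝ))⟫ * (t * ⟪fderiv ℝ V (axisPt s t θ)
          (rotZ θ (EuclideanSpace.single (1 : Fin 3) (1 : ℝ))), rotZ θ
          (EuclideanSpace.single (1 : Fin 3) (1 : ℝ))⟫ - ⟪V (axisPt s t θ), rotZ θ
          (EuclideanSpace.single (0 : Fin 3) (1 : ℝ))⟫) +
          ⟪c, rotZ θ (EuclideanSpace.single (1 : Fin 3) (1 : ℝ))⟫ * (t * ⟪fderiv ℝ V (axisPt s t θ)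
              (rotZ θ (EuclideanSpace.single (1 : Fin 3) (1 : ℝ))), rotZ θ
              (EuclideanSpace.single (0 : Fin 3) (1 : ℝ))⟫ + ⟪V (axisPt s t θ), rotZ θ
              (EuclideanSpace.single (1 : Fin 3) (1 : ℝ))⟫)) -
        (⟪c, rotZ θ (EuclideanSpace.single (0 : Fin 3) (1 : ℝ))⟫ * ⟪V (axisPt s t θ), rotZ θ
            (EuclideanSpace.single (0 : Fin 3) (1 : ℝ))⟫ - ⟪c, rotZ θ (EuclideanSpace.single (1 : Fin 3) (1 : ℝ))⟫
            * ⟪V (axisPt s t θ), rotZ θ (EuclideanSpace.single (1 : Fin 3) (1 : ℝ))⟫) -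
        t * (⟪c, rotZ θ (EuclideanSpace.single (0 : Fin 3) (1 : ℝ))⟫ * ⟪fderiv ℝ V (axisPt s t θ) eZ, eZ⟫ + ⟪c,
            rotZ θ (EuclideanSpace.single (1 : Fin 3) (1 : ℝ))⟫ * (⟪fderiv ℝ V (axisPt s t θ) (rotZ θ
            (EuclideanSpace.single (0 : Fin 3) (1 : ℝ))), rotZ θ
            (EuclideanSpace.single (1 : Fin 3) (1 : ℝ))⟫ - ⟪fderiv ℝ V (axisPt s t θ) (rotZ θ
            (EuclideanSpace.single (1 : Fin 3) (1 : ℝ))), rotZ θ (EuclideanSpace.single (0 : Fin 3) (1 : ℝ))⟫)) := by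
    intro θ
    have h := sliceChart_hdiv hdiv s t θ
    linear_combination (⟪c, rotZ θ (EuclideanSpace.single (0 : Fin 3) (1 : ℝ))⟫) * h
  -- (2) the boundary term: `∫_θ [c_r ∂_θ b + c_θ ∂_θ a] = m` (product rule + periodicity)
  have hprod : ∀ θ, HasDerivAt (fun θ : ℝ => ⟪c, rotZ θ (EuclideanSpace.single (0 : Fin 3) (1 : ℝ))⟫
      * ⟪V (axisPt s t θ), rotZ θ (EuclideanSpace.single (1 : Fin 3) (1 : ℝ))⟫ + ⟪c, rotZ θ
      (EuclideanSpace.single (1 : Fin 3) (1 : ℝ))⟫ * ⟪V (axisPt s t θ), rotZ θ (EuclideanSpace.single (0 : Fin 3) (1 : ℝ))⟫)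
      (⟪c, rotZ θ (EuclideanSpace.single (1 : Fin 3) (1 : ℝ))⟫ * ⟪V (axisPt s t θ), rotZ θ
          (EuclideanSpace.single (1 : Fin 3) (1 : ℝ))⟫ + ⟪c, rotZ θ (EuclideanSpace.single (0 : Fin 3) (1 : ℝ))⟫ * (t
          * ⟪fderiv ℝ V (axisPt s t θ) (rotZ θ (EuclideanSpace.single (1 : Fin 3) (1 : ℝ))), rotZ θ
          (EuclideanSpace.single (1 : Fin 3) (1 : ℝ))⟫ - ⟪V (axisPt s t θ), rotZ θ
          (EuclideanSpace.single (0 : Fin 3) (1 : ℝ))⟫) +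
        (-⟪c, rotZ θ (EuclideanSpace.single (0 : Fin 3) (1 : ℝ))⟫ * ⟪V (axisPt s t θ), rotZ θ
            (EuclideanSpace.single (0 : Fin 3) (1 : ℝ))⟫ + ⟪c, rotZ θ (EuclideanSpace.single (1 : Fin 3) (1 : ℝ))⟫ * (t
            * ⟪fderiv ℝ V (axisPt s t θ) (rotZ θ (EuclideanSpace.single (1 : Fin 3) (1 : ℝ))), rotZ θ
            (EuclideanSpace.single (0 : Fin 3) (1 : ℝ))⟫ + ⟪V (axisPt s t θ), rotZ θ
            (EuclideanSpace.single (1 : Fin 3) (1 : ℝ))⟫))) θ := by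
    intro θ
    exact ((hasDerivAt_inner_rotZ_single_zero c θ).mul (hasDerivAt_sliceB_angle hVd s t θ)).add
      ((hasDerivAt_inner_rotZ_single_one c θ).mul (hasDerivAt_sliceA_angle hVd s t θ))
  have hderc : Continuous fun θ : ℝ => ⟪c, rotZ θ (EuclideanSpace.single (1 : Fin 3) (1 : ℝ))⟫ * ⟪V (axisPt s t θ),
      rotZ θ (EuclideanSpace.single (1 : Fin 3) (1 : ℝ))⟫ + ⟪c, rotZ θ (EuclideanSpace.single (0 : Fin 3) (1 : ℝ))⟫ * (t
      * ⟪fderiv ℝ V (axisPt s t θ) (rotZ θ (EuclideanSpace.single (1 : Fin 3) (1 : ℝ))), rotZ θ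
      (EuclideanSpace.single (1 : Fin 3) (1 : ℝ))⟫ - ⟪V (axisPt s t θ), rotZ θ (EuclideanSpace.single (0 : Fin 3) (1 : ℝ))⟫) +
      (-⟪c, rotZ θ (EuclideanSpace.single (0 : Fin 3) (1 : ℝ))⟫ * ⟪V (axisPt s t θ), rotZ θ
          (EuclideanSpace.single (0 : Fin 3) (1 : ℝ))⟫ + ⟪c, rotZ θ (EuclideanSpace.single (1 : Fin 3) (1 : ℝ))⟫ * (t
          * ⟪fderiv ℝ V (axisPt s t θ) (rotZ θ (EuclideanSpace.single (1 : Fin 3) (1 : ℝ))), rotZ θ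
          (EuclideanSpace.single (0 : Fin 3) (1 : ℝ))⟫ + ⟪V (axisPt s t θ), rotZ θ
          (EuclideanSpace.single (1 : Fin 3) (1 : ℝ))⟫)) := by
    have h4 : Continuous fun θ : ℝ => t * ⟪fderiv ℝ V (axisPt s t θ) (rotZ θ
        (EuclideanSpace.single (1 : Fin 3) (1 : ℝ))), rotZ θ
        (EuclideanSpace.single (1 : Fin 3) (1 : ℝ))⟫ - ⟪V (axisPt s t θ), rotZ θ
        (EuclideanSpace.single (0 : Fin 3) (1 : ℝ))⟫ := (continuous_const.mul hmθ).sub ha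
    have h5 : Continuous fun θ : ℝ => t * ⟪fderiv ℝ V (axisPt s t θ) (rotZ θ
        (EuclideanSpace.single (1 : Fin 3) (1 : ℝ))), rotZ θ
        (EuclideanSpace.single (0 : Fin 3) (1 : ℝ))⟫ + ⟪V (axisPt s t θ), rotZ θ
        (EuclideanSpace.single (1 : Fin 3) (1 : ℝ))⟫ := (continuous_const.mul hmr).add hb
    exact ((hcθ.mul hb).add (hcr.mul h4)).add ((hcr.neg.mul ha).add (hcθ.mul h5))
  have hFTC := intervalIntegral.integral_eq_sub_of_hasDerivAt (a := 0) (b := 2 * π) (fun θ _ => hprod θ)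
    (hderc.intervalIntegrable _ _)
  rw [axisPt_two_pi, rotZ_two_pi_single_zero, rotZ_two_pi_single_one, sub_self] at hFTC
  -- hFTC : ∫ (c_θ b + c_r bθ' + (−c_r a + c_θ aθ')) = 0
  -- (3) assemble: integrate `hpt` over `θ`
  have i_m : IntervalIntegrable (fun θ => ⟪c, rotZ θ (EuclideanSpace.single (0 : Fin 3) (1 : ℝ))⟫ * ⟪V (axisPt s t θ),
      rotZ θ (EuclideanSpace.single (0 : Fin 3) (1 : ℝ))⟫ - ⟪c, rotZ θ (EuclideanSpace.single (1 : Fin 3) (1 : ℝ))⟫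
      * ⟪V (axisPt s t θ), rotZ θ (EuclideanSpace.single (1 : Fin 3) (1 : ℝ))⟫) volume 0 (2 * π) :=
    ((hcr.mul ha).sub (hcθ.mul hb)).intervalIntegrable _ _
  have i_md : IntervalIntegrable (fun θ => ⟪c, rotZ θ (EuclideanSpace.single (0 : Fin 3) (1 : ℝ))⟫
      * ⟪fderiv ℝ V (axisPt s t θ) (rotZ θ (EuclideanSpace.single (0 : Fin 3) (1 : ℝ))), rotZ θ
      (EuclideanSpace.single (0 : Fin 3) (1 : ℝ))⟫ - ⟪c, rotZ θ (EuclideanSpace.single (1 : Fin 3) (1 : ℝ))⟫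
      * ⟪fderiv ℝ V (axisPt s t θ) (rotZ θ (EuclideanSpace.single (0 : Fin 3) (1 : ℝ))), rotZ θ
      (EuclideanSpace.single (1 : Fin 3) (1 : ℝ))⟫) volume 0 (2 * π) :=
    ((hcr.mul had).sub (hcθ.mul hbd)).intervalIntegrable _ _
  have i_n : IntervalIntegrable (fun θ => ⟪c, rotZ θ (EuclideanSpace.single (0 : Fin 3) (1 : ℝ))⟫
      * ⟪fderiv ℝ V (axisPt s t θ) eZ, eZ⟫ + ⟪c, rotZ θ
      (EuclideanSpace.single (1 : Fin 3) (1 : ℝ))⟫ * (⟪fderiv ℝ V (axisPt s t θ) (rotZ θ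
      (EuclideanSpace.single (0 : Fin 3) (1 : ℝ))), rotZ θ
      (EuclideanSpace.single (1 : Fin 3) (1 : ℝ))⟫ - ⟪fderiv ℝ V (axisPt s t θ) (rotZ θ
      (EuclideanSpace.single (1 : Fin 3) (1 : ℝ))), rotZ θ (EuclideanSpace.single (0 : Fin 3) (1 : ℝ))⟫)) volume 0 (2 * π) :=
    ((hcr.mul hcs).add (hcθ.mul (hbd.sub hmr))).intervalIntegrable _ _
  have i_ibp : IntervalIntegrable (fun θ => ⟪c, rotZ θ (EuclideanSpace.single (0 : Fin 3) (1 : ℝ))⟫ * (t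
      * ⟪fderiv ℝ V (axisPt s t θ) (rotZ θ (EuclideanSpace.single (1 : Fin 3) (1 : ℝ))), rotZ θ
      (EuclideanSpace.single (1 : Fin 3) (1 : ℝ))⟫ - ⟪V (axisPt s t θ), rotZ θ (EuclideanSpace.single (0 : Fin 3) (1 : ℝ))⟫) +
      ⟪c, rotZ θ (EuclideanSpace.single (1 : Fin 3) (1 : ℝ))⟫ * (t * ⟪fderiv ℝ V (axisPt s t θ) (rotZ θ
          (EuclideanSpace.single (1 : Fin 3) (1 : ℝ))), rotZ θ
          (EuclideanSpace.single (0 : Fin 3) (1 : ℝ))⟫ + ⟪V (axisPt s t θ), rotZ θ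
          (EuclideanSpace.single (1 : Fin 3) (1 : ℝ))⟫)) volume 0 (2 * π) :=
    ((hcr.mul ((continuous_const.mul hmθ).sub ha)).add (hcθ.mul ((continuous_const.mul hmr).add hb))).intervalIntegrable _ _
  -- the IBP integral equals `m`
  have hibp : ∫ θ in (0 : ℝ)..2 * π, (⟪c, rotZ θ (EuclideanSpace.single (0 : Fin 3) (1 : ℝ))⟫ * (t
      * ⟪fderiv ℝ V (axisPt s t θ) (rotZ θ (EuclideanSpace.single (1 : Fin 3) (1 : ℝ))), rotZ θ
      (EuclideanSpace.single (1 : Fin 3) (1 : ℝ))⟫ - ⟪V (axisPt s t θ), rotZ θ (EuclideanSpace.single (0 : Fin 3) (1 : ℝ))⟫) +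
      ⟪c, rotZ θ (EuclideanSpace.single (1 : Fin 3) (1 : ℝ))⟫ * (t * ⟪fderiv ℝ V (axisPt s t θ) (rotZ θ
          (EuclideanSpace.single (1 : Fin 3) (1 : ℝ))), rotZ θ
          (EuclideanSpace.single (0 : Fin 3) (1 : ℝ))⟫ + ⟪V (axisPt s t θ), rotZ θ
          (EuclideanSpace.single (1 : Fin 3) (1 : ℝ))⟫)) = ∫ θ in (0 : ℝ)..2 * π, (⟪c, rotZ θ
          (EuclideanSpace.single (0 : Fin 3) (1 : ℝ))⟫ * ⟪V (axisPt s t θ), rotZ θ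
          (EuclideanSpace.single (0 : Fin 3) (1 : ℝ))⟫ - ⟪c, rotZ θ (EuclideanSpace.single (1 : Fin 3) (1 : ℝ))⟫
          * ⟪V (axisPt s t θ), rotZ θ (EuclideanSpace.single (1 : Fin 3) (1 : ℝ))⟫) := by
    have i1 : IntervalIntegrable (fun θ => ⟪c, rotZ θ (EuclideanSpace.single (1 : Fin 3) (1 : ℝ))⟫ * ⟪V (axisPt s t θ),
        rotZ θ (EuclideanSpace.single (1 : Fin 3) (1 : ℝ))⟫ + ⟪c, rotZ θ (EuclideanSpace.single (0 : Fin 3) (1 : ℝ))⟫ * (t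
        * ⟪fderiv ℝ V (axisPt s t θ) (rotZ θ (EuclideanSpace.single (1 : Fin 3) (1 : ℝ))), rotZ θ
        (EuclideanSpace.single (1 : Fin 3) (1 : ℝ))⟫ - ⟪V (axisPt s t θ), rotZ θ
        (EuclideanSpace.single (0 : Fin 3) (1 : ℝ))⟫) +
        (-⟪c, rotZ θ (EuclideanSpace.single (0 : Fin 3) (1 : ℝ))⟫ * ⟪V (axisPt s t θ), rotZ θ
            (EuclideanSpace.single (0 : Fin 3) (1 : ℝ))⟫ + ⟪c, rotZ θ (EuclideanSpace.single (1 : Fin 3) (1 : ℝ))⟫ * (t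
            * ⟪fderiv ℝ V (axisPt s t θ) (rotZ θ (EuclideanSpace.single (1 : Fin 3) (1 : ℝ))), rotZ θ
            (EuclideanSpace.single (0 : Fin 3) (1 : ℝ))⟫ + ⟪V (axisPt s t θ), rotZ θ
            (EuclideanSpace.single (1 : Fin 3) (1 : ℝ))⟫))) volume 0 (2 * π) := hderc.intervalIntegrable _ _
    have hsplit : ∫ θ in (0 : ℝ)..2 * π, (⟪c, rotZ θ (EuclideanSpace.single (1 : Fin 3) (1 : ℝ))⟫ * ⟪V (axisPt s t θ),
        rotZ θ (EuclideanSpace.single (1 : Fin 3) (1 : ℝ))⟫ + ⟪c, rotZ θ (EuclideanSpace.single (0 : Fin 3) (1 : ℝ))⟫ * (t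
        * ⟪fderiv ℝ V (axisPt s t θ) (rotZ θ (EuclideanSpace.single (1 : Fin 3) (1 : ℝ))), rotZ θ
        (EuclideanSpace.single (1 : Fin 3) (1 : ℝ))⟫ - ⟪V (axisPt s t θ), rotZ θ
        (EuclideanSpace.single (0 : Fin 3) (1 : ℝ))⟫) +
        (-⟪c, rotZ θ (EuclideanSpace.single (0 : Fin 3) (1 : ℝ))⟫ * ⟪V (axisPt s t θ), rotZ θ
            (EuclideanSpace.single (0 : Fin 3) (1 : ℝ))⟫ + ⟪c, rotZ θ (EuclideanSpace.single (1 : Fin 3) (1 : ℝ))⟫ * (t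
            * ⟪fderiv ℝ V (axisPt s t θ) (rotZ θ (EuclideanSpace.single (1 : Fin 3) (1 : ℝ))), rotZ θ
            (EuclideanSpace.single (0 : Fin 3) (1 : ℝ))⟫ + ⟪V (axisPt s t θ), rotZ θ
            (EuclideanSpace.single (1 : Fin 3) (1 : ℝ))⟫))) =
        (∫ θ in (0 : ℝ)..2 * π, (⟪c, rotZ θ (EuclideanSpace.single (0 : Fin 3) (1 : ℝ))⟫ * (t
            * ⟪fderiv ℝ V (axisPt s t θ) (rotZ θ (EuclideanSpace.single (1 : Fin 3) (1 : ℝ))), rotZ θ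
            (EuclideanSpace.single (1 : Fin 3) (1 : ℝ))⟫ - ⟪V (axisPt s t θ), rotZ θ
            (EuclideanSpace.single (0 : Fin 3) (1 : ℝ))⟫) +
          ⟪c, rotZ θ (EuclideanSpace.single (1 : Fin 3) (1 : ℝ))⟫ * (t * ⟪fderiv ℝ V (axisPt s t θ)
              (rotZ θ (EuclideanSpace.single (1 : Fin 3) (1 : ℝ))), rotZ θ
              (EuclideanSpace.single (0 : Fin 3) (1 : ℝ))⟫ + ⟪V (axisPt s t θ), rotZ θ
              (EuclideanSpace.single (1 : Fin 3) (1 : ℝ))⟫))) - ∫ θ in (0 : ℝ)..2 * π, (⟪c, rotZ θ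
              (EuclideanSpace.single (0 : Fin 3) (1 : ℝ))⟫ * ⟪V (axisPt s t θ), rotZ θ
              (EuclideanSpace.single (0 : Fin 3) (1 : ℝ))⟫ - ⟪c, rotZ θ (EuclideanSpace.single (1 : Fin 3) (1 : ℝ))⟫
              * ⟪V (axisPt s t θ), rotZ θ (EuclideanSpace.single (1 : Fin 3) (1 : ℝ))⟫) := by
      rw [← intervalIntegral.integral_sub i_ibp i_m]
      exact intervalIntegral.integral_congr fun θ _ => by ring
    linarith [hFTC, hsplit]
  -- `t * m' = ∫ t * (…)` and the pointwise identity
  have i_ibpn : IntervalIntegrable (fun θ => -(⟪c, rotZ θ (EuclideanSpace.single (0 : Fin 3) (1 : ℝ))⟫ * (t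
      * ⟪fderiv ℝ V (axisPt s t θ) (rotZ θ (EuclideanSpace.single (1 : Fin 3) (1 : ℝ))), rotZ θ
      (EuclideanSpace.single (1 : Fin 3) (1 : ℝ))⟫ - ⟪V (axisPt s t θ), rotZ θ (EuclideanSpace.single (0 : Fin 3) (1 : ℝ))⟫) +
      ⟪c, rotZ θ (EuclideanSpace.single (1 : Fin 3) (1 : ℝ))⟫ * (t * ⟪fderiv ℝ V (axisPt s t θ) (rotZ θ
          (EuclideanSpace.single (1 : Fin 3) (1 : ℝ))), rotZ θ
          (EuclideanSpace.single (0 : Fin 3) (1 : ℝ))⟫ + ⟪V (axisPt s t θ), rotZ θ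
          (EuclideanSpace.single (1 : Fin 3) (1 : ℝ))⟫))) volume 0 (2 * π) :=
    ((hcr.mul ((continuous_const.mul hmθ).sub ha)).add (hcθ.mul ((continuous_const.mul hmr).add hb))).neg.intervalIntegrable _ _
  have i_big : IntervalIntegrable (fun θ => -(⟪c, rotZ θ (EuclideanSpace.single (0 : Fin 3) (1 : ℝ))⟫ * (t
      * ⟪fderiv ℝ V (axisPt s t θ) (rotZ θ (EuclideanSpace.single (1 : Fin 3) (1 : ℝ))), rotZ θ
      (EuclideanSpace.single (1 : Fin 3) (1 : ℝ))⟫ - ⟪V (axisPt s t θ), rotZ θ (EuclideanSpace.single (0 : Fin 3) (1 : ℝ))⟫) +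
      ⟪c, rotZ θ (EuclideanSpace.single (1 : Fin 3) (1 : ℝ))⟫ * (t * ⟪fderiv ℝ V (axisPt s t θ) (rotZ θ
          (EuclideanSpace.single (1 : Fin 3) (1 : ℝ))), rotZ θ
          (EuclideanSpace.single (0 : Fin 3) (1 : ℝ))⟫ + ⟪V (axisPt s t θ), rotZ θ
          (EuclideanSpace.single (1 : Fin 3) (1 : ℝ))⟫)) - (⟪c, rotZ θ (EuclideanSpace.single (0 : Fin 3) (1 : ℝ))⟫
          * ⟪V (axisPt s t θ), rotZ θ (EuclideanSpace.single (0 : Fin 3) (1 : ℝ))⟫ - ⟪c, rotZ θ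
          (EuclideanSpace.single (1 : Fin 3) (1 : ℝ))⟫ * ⟪V (axisPt s t θ), rotZ θ
          (EuclideanSpace.single (1 : Fin 3) (1 : ℝ))⟫)) volume 0 (2 * π) :=
    (((hcr.mul ((continuous_const.mul hmθ).sub ha)).add (hcθ.mul ((continuous_const.mul hmr).add hb))).neg.sub
      ((hcr.mul ha).sub (hcθ.mul hb))).intervalIntegrable _ _
  have i_tn : IntervalIntegrable (fun θ => t * (⟪c, rotZ θ (EuclideanSpace.single (0 : Fin 3) (1 : ℝ))⟫
      * ⟪fderiv ℝ V (axisPt s t θ) eZ, eZ⟫ + ⟪c, rotZ θ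
      (EuclideanSpace.single (1 : Fin 3) (1 : ℝ))⟫ * (⟪fderiv ℝ V (axisPt s t θ) (rotZ θ
      (EuclideanSpace.single (0 : Fin 3) (1 : ℝ))), rotZ θ
      (EuclideanSpace.single (1 : Fin 3) (1 : ℝ))⟫ - ⟪fderiv ℝ V (axisPt s t θ) (rotZ θ
      (EuclideanSpace.single (1 : Fin 3) (1 : ℝ))), rotZ θ (EuclideanSpace.single (0 : Fin 3) (1 : ℝ))⟫))) volume 0 (2 * π) :=
    (continuous_const.mul ((hcr.mul hcs).add (hcθ.mul (hbd.sub hmr)))).intervalIntegrable _ _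
  have hmain : t * (∫ θ in (0 : ℝ)..2 * π, (⟪c, rotZ θ (EuclideanSpace.single (0 : Fin 3) (1 : ℝ))⟫
      * ⟪fderiv ℝ V (axisPt s t θ) (rotZ θ (EuclideanSpace.single (0 : Fin 3) (1 : ℝ))), rotZ θ
      (EuclideanSpace.single (0 : Fin 3) (1 : ℝ))⟫ - ⟪c, rotZ θ (EuclideanSpace.single (1 : Fin 3) (1 : ℝ))⟫
      * ⟪fderiv ℝ V (axisPt s t θ) (rotZ θ (EuclideanSpace.single (0 : Fin 3) (1 : ℝ))), rotZ θ
      (EuclideanSpace.single (1 : Fin 3) (1 : ℝ))⟫)) =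
      -(∫ θ in (0 : ℝ)..2 * π, (⟪c, rotZ θ (EuclideanSpace.single (0 : Fin 3) (1 : ℝ))⟫ * (t
          * ⟪fderiv ℝ V (axisPt s t θ) (rotZ θ (EuclideanSpace.single (1 : Fin 3) (1 : ℝ))), rotZ θ
          (EuclideanSpace.single (1 : Fin 3) (1 : ℝ))⟫ - ⟪V (axisPt s t θ), rotZ θ
          (EuclideanSpace.single (0 : Fin 3) (1 : ℝ))⟫) +
          ⟪c, rotZ θ (EuclideanSpace.single (1 : Fin 3) (1 : ℝ))⟫ * (t * ⟪fderiv ℝ V (axisPt s t θ)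
              (rotZ θ (EuclideanSpace.single (1 : Fin 3) (1 : ℝ))), rotZ θ
              (EuclideanSpace.single (0 : Fin 3) (1 : ℝ))⟫ + ⟪V (axisPt s t θ), rotZ θ
              (EuclideanSpace.single (1 : Fin 3) (1 : ℝ))⟫))) -
        (∫ θ in (0 : ℝ)..2 * π, (⟪c, rotZ θ (EuclideanSpace.single (0 : Fin 3) (1 : ℝ))⟫ * ⟪V (axisPt s t θ),
            rotZ θ (EuclideanSpace.single (0 : Fin 3) (1 : ℝ))⟫ - ⟪c, rotZ θ (EuclideanSpace.single (1 : Fin 3) (1 : ℝ))⟫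
            * ⟪V (axisPt s t θ), rotZ θ (EuclideanSpace.single (1 : Fin 3) (1 : ℝ))⟫)) - t * ∫ θ in (0 : ℝ)..2 * π, (⟪c,
            rotZ θ (EuclideanSpace.single (0 : Fin 3) (1 : ℝ))⟫ * ⟪fderiv ℝ V (axisPt s t θ) eZ, eZ⟫ + ⟪c,
            rotZ θ (EuclideanSpace.single (1 : Fin 3) (1 : ℝ))⟫ * (⟪fderiv ℝ V (axisPt s t θ) (rotZ θ
            (EuclideanSpace.single (0 : Fin 3) (1 : ℝ))), rotZ θ
            (EuclideanSpace.single (1 : Fin 3) (1 : ℝ))⟫ - ⟪fderiv ℝ V (axisPt s t θ) (rotZ θ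
            (EuclideanSpace.single (1 : Fin 3) (1 : ℝ))), rotZ θ (EuclideanSpace.single (0 : Fin 3) (1 : ℝ))⟫)) := by
    rw [← intervalIntegral.integral_const_mul t, ← intervalIntegral.integral_const_mul t,
      ← intervalIntegral.integral_neg, ← intervalIntegral.integral_sub i_ibpn i_m,
      ← intervalIntegral.integral_sub i_big i_tn]
    exact intervalIntegral.integral_congr fun θ _ => hpt θ
  rw [hibp] at hmain
  linarith [hmain]

/-- The cross mode vanishes on the axis: `∫_θ (c_r a − c_θ b)(s, 0, θ) dθ = 0` (a pure second azimuthal mode). [folklore] -/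
theorem crossMode_axis_zero (V : EuclideanSpace ℝ (Fin 3) → EuclideanSpace ℝ (Fin 3)) (c : EuclideanSpace ℝ (Fin 3)) (s : ℝ) :
    ∫ θ in (0 : ℝ)..2 * π, (⟪c, rotZ θ (EuclideanSpace.single (0 : Fin 3) (1 : ℝ))⟫ * ⟪V (axisPt s 0 θ),
        rotZ θ (EuclideanSpace.single (0 : Fin 3) (1 : ℝ))⟫ - ⟪c, rotZ θ (EuclideanSpace.single (1 : Fin 3) (1 : ℝ))⟫
        * ⟪V (axisPt s 0 θ), rotZ θ (EuclideanSpace.single (1 : Fin 3) (1 : ℝ))⟫) = 0 := by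
  have hfun : (fun θ : ℝ => ⟪c, rotZ θ (EuclideanSpace.single (0 : Fin 3) (1 : ℝ))⟫ * ⟪V (axisPt s 0 θ),
      rotZ θ (EuclideanSpace.single (0 : Fin 3) (1 : ℝ))⟫ - ⟪c, rotZ θ (EuclideanSpace.single (1 : Fin 3) (1 : ℝ))⟫
      * ⟪V (axisPt s 0 θ), rotZ θ (EuclideanSpace.single (1 : Fin 3) (1 : ℝ))⟫) =
      fun θ => (c 0 * V (s • eZ) 0 - c 1 * V (s • eZ) 1) * Real.cos θ ^ 2 -
        (c 0 * V (s • eZ) 0 - c 1 * V (s • eZ) 1) * Real.sin θ ^ 2 +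
        (2 * (c 0 * V (s • eZ) 1 + c 1 * V (s • eZ) 0)) * (Real.sin θ * Real.cos θ) := by
    funext θ
    rw [axisPt_radius_zero, inner_rotZ_single_zero, inner_rotZ_single_one, inner_rotZ_single_zero,
      inner_rotZ_single_one]
    ring
  have h1 : IntervalIntegrable (fun θ : ℝ => (c 0 * V (s • eZ) 0 - c 1 * V (s • eZ) 1) * Real.cos θ ^ 2) volume 0 (2 * π) :=
    (continuous_const.mul (continuous_cos.pow 2)).intervalIntegrable _ _
  have h2 : IntervalIntegrable (fun θ : ℝ => (c 0 * V (s • eZ) 0 - c 1 * V (s • eZ) 1) * Real.sin θ ^ 2) volume 0 (2 * π) :=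
    (continuous_const.mul (continuous_sin.pow 2)).intervalIntegrable _ _
  have h12 : IntervalIntegrable (fun θ : ℝ => (c 0 * V (s • eZ) 0 - c 1 * V (s • eZ) 1) * Real.cos θ ^ 2 -
      (c 0 * V (s • eZ) 0 - c 1 * V (s • eZ) 1) * Real.sin θ ^ 2) volume 0 (2 * π) := h1.sub h2
  have h3 : IntervalIntegrable (fun θ : ℝ => (2 * (c 0 * V (s • eZ) 1 + c 1 * V (s • eZ) 0)) * (Real.sin θ * Real.cos θ))
      volume 0 (2 * π) := (continuous_const.mul (continuous_sin.mul continuous_cos)).intervalIntegrable _ _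
  rw [hfun, intervalIntegral.integral_add h12 h3, intervalIntegral.integral_sub h1 h2, intervalIntegral.integral_const_mul,
    intervalIntegral.integral_const_mul, intervalIntegral.integral_const_mul, integral_cos_sq_two_pi, integral_sin_sq_two_pi,
    integral_sin_mul_cos_two_pi]
  ring

end Summit.NavierStokesRegularity.NavierStokesRegularity.Theorems.PowerGaugeEulerLiouville.HoopCore

end
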